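import Summits.KontsevichZagierPeriods.KontsevichZagierPeriods.Theorems.LinRedNormalFormBeukersZeta3Charts
import Summits.KontsevichZagierPeriods.KontsevichZagierPeriods.Theorems.LinRedNormalFormArrangementNormalFormStubIntegrateOutLowHelpers
import Literature.NumberTheory.Transcendental.MZVSimplexRep
import Literature.NumberTheory.Transcendental.KZProductIdeal
import Literature.NumberTheory.Transcendental.KZRelationsLE

/-!
# `WheelThreeSpokes` (stmt-KontsevichZagierPeriods-3913, route LinRedNormalForm): chart tools

Support file for the move chain of line `laplacian-ldl-chart` (crux `WheelThreeSpokes`,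
`[ℝ₊⁵, 1/Ψ_{K₄}(x,1)²] ~ [Δ₃, 6/(t₀t₁(1−t₂))]`). General-purpose moves of the Kontsevich–Zagier
calculus used by the stubs of the line:

* `hasFDerivAt_aeval_div`, `ratChart_transport` — ONE change-of-variables move (rule (2)) along a
  RATIONAL chart `C(y)ᵢ = Pᵢ(y)/Qᵢ(y)` (`Pᵢ, Qᵢ ∈ ℚ[y]`, `Qᵢ ≠ 0` on the domain), packaged with the
  transport of absolute integrability in both directions, exactly as `polyChart_transport` of
  `LinRedNormalFormBeukersZeta3Charts.lean` does for polynomial charts: the Jacobian matrix is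
  `((∂ⱼPᵢ)/Qᵢ − Pᵢ(∂ⱼQᵢ)/Qᵢ²)`, so only its determinant has to be identified by hand (with a
  quotient `J_P/J_Q` of polynomials);
* `exists_unfold_step_fun` — reverse Newton–Leibniz unfolding `[τ, (b − a)·g] ≡ [{a < t < b}, g∘init]`
  with SEMIALGEBRAIC (not necessarily polynomial) fibre ends `a < b` (rule (3) with the primitive
  `(t − a x)·g x`, then the null opening of the closed fibres); generalises
  `JanusBands.IntegrateOutLow.exists_unfold_step`;
* `of_sub_nsmul_of_mem_relations` — `[σ, c·g] ≡ c·[σ, g]` for `c : ℕ` (iterated rule (1b));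
* the two MZV word representations of weight three on the typed simplex
  `{1 > t₀ > t₁ > t₂ > 0}`: existence (`exists_zeta3Word_rep`, `exists_zeta21Word_rep`, absolute
  convergence from `KZ.integrableOn_prod_mzvForm`) and the duality move `ζ(2,1) ~ ζ(3)`
  (`zeta21Word_sub_zeta3Word_mem_relations`: the affine involution `tᵢ ↦ 1 − t_{2−i}` of the
  simplex is one polynomial change of variables, `|det| = 1`; pattern of route FurushoPentagon's
  `DualityInKZ`, re-proved here to keep this file inside route LinRedNormalForm).

References: M. Kontsevich, D. Zagier, *Periods* (2001), §1.2 rules (1)–(3); J. Bochnak, M. Coste,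
M.-F. Roy, *Real Algebraic Geometry* (1998), §2.2; D. Zagier, *Values of zeta functions and their
applications* (1994), §9 (duality).
-/

noncomputable section

open Set MeasureTheory MvPolynomial
open Literature.NumberTheory.Transcendental
open Literature.ModelTheory.ExponentialFields (IsSemialgebraic isSemialgebraic_setOf_eval_lt)

namespace Summit.KontsevichZagierPeriods.LinRedNormalForm.WheelThreeSpokes

/-! ## Rational charts -/

/-- The Fréchet derivative of a quotient `P/Q` of real polynomial functions at a point where
`Q ≠ 0` (quotient rule). [folklore] -/
theorem hasFDerivAt_aeval_div {N : ℕ} (P Q : MvPolynomial (Fin N) ℚ) (y : Fin N → ℝ)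
    (hQ : aeval y Q ≠ 0) :
    HasFDerivAt (fun x : Fin N → ℝ => aeval x P / aeval x Q)
      ((aeval y Q)⁻¹ • fderiv ℝ (fun x : Fin N → ℝ => aeval x P) y -
        (aeval y P / aeval y Q ^ 2) • fderiv ℝ (fun x : Fin N → ℝ => aeval x Q) y) y := by
  have hP : HasFDerivAt (fun x : Fin N → ℝ => aeval x P)
      (fderiv ℝ (fun x : Fin N → ℝ => aeval x P) y) y :=
    ((contDiff_aeval_real (n := 1) P).differentiable one_ne_zero y).hasFDerivAt
  have hQ' : HasFDerivAt (fun x : Fin N → ℝ => aeval x Q)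
      (fderiv ℝ (fun x : Fin N → ℝ => aeval x Q) y) y :=
    ((contDiff_aeval_real (n := 1) Q).differentiable one_ne_zero y).hasFDerivAt
  have hinv := ((hasDerivAt_inv hQ).hasFDerivAt.comp y hQ')
  have hmul := hP.mul hinv
  have hfun : (fun x : Fin N → ℝ => aeval x P / aeval x Q) =
      fun x => aeval x P * ((fun t : ℝ => t⁻¹) ∘ fun x : Fin N → ℝ => aeval x Q) x := by
    funext x; simp [div_eq_mul_inv]
  rw [hfun]
  refine hmul.congr_fderiv ?_
  ext v
  simp
  ring

/-- **Transport along a rational chart** `C(y) = (P₀/Q₀, …, P_{N-1}/Q_{N-1})(y)`, `Pᵢ, Qᵢ ∈ ℚ[y]`,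
all `Qᵢ` non-vanishing on the `ℚ`-semialgebraic `D`: `C` is a `ℚ`-semialgebraic map on `D`
(coordinatewise quotients of polynomials) and differentiable at every point of `D` with Jacobian
matrix `((∂ⱼPᵢ)/Qᵢ − Pᵢ(∂ⱼQᵢ)/Qᵢ²)`; so `chart_transport` applies as soon as the Jacobian determinant
is identified on `D` with a quotient `J_P/J_Q` of polynomials (`J_Q ≠ 0` on `D`), the chart is
injective on `D`, and `g = (h ∘ C)·|J_P/J_Q|` there. Conclusions as in `chart_transport`:
existence transport, integrability transport, and the change-of-variables move between every
representation `(D, ≡ g)` and every representation `(C '' D, ≡ h)`.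
[cite: KontsevichZagier2001, §1.2 rule (2)] -/
theorem ratChart_transport {N : ℕ} (P Q : Fin N → MvPolynomial (Fin N) ℚ)
    (JP JQ : MvPolynomial (Fin N) ℚ) {D : Set (Fin N → ℝ)} (hD : IsSemialgebraic ℚ D)
    (hQ : ∀ y ∈ D, ∀ i, aeval y (Q i) ≠ 0) (hJQ : ∀ y ∈ D, aeval y JQ ≠ 0)
    (hJ : ∀ y ∈ D, (Matrix.of fun i j =>
        (aeval y (Q i))⁻¹ * aeval y (pderiv j (P i)) -
          aeval y (P i) / aeval y (Q i) ^ 2 * aeval y (pderiv j (Q i)) :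
        Matrix (Fin N) (Fin N) ℝ).det = aeval y JP / aeval y JQ)
    (hinj : InjOn (fun (x : Fin N → ℝ) (i : Fin N) => aeval x (P i) / aeval x (Q i)) D)
    (g h : (Fin N → ℝ) → ℝ)
    (hgh : ∀ y ∈ D, g y = h (fun i => aeval y (P i) / aeval y (Q i)) * |aeval y JP / aeval y JQ|) :
    (∀ r' : KZ.IntegralRep N,
        r'.domain = (fun (x : Fin N → ℝ) (i : Fin N) => aeval x (P i) / aeval x (Q i)) '' D →
        EqOn r'.integrand h r'.domain → ∃ r : KZ.IntegralRep N, r.domain = D ∧ r.integrand = g) ∧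
    (∀ r : KZ.IntegralRep N, r.domain = D → EqOn r.integrand g D →
        IntegrableOn h ((fun (x : Fin N → ℝ) (i : Fin N) => aeval x (P i) / aeval x (Q i)) '' D)) ∧
    (∀ r r' : KZ.IntegralRep N, r.domain = D → EqOn r.integrand g D →
        r'.domain = (fun (x : Fin N → ℝ) (i : Fin N) => aeval x (P i) / aeval x (Q i)) '' D →
        EqOn r'.integrand h r'.domain → KZ.Equivalent r r') := by
  set C : (Fin N → ℝ) → (Fin N → ℝ) := fun x i => aeval x (P i) / aeval x (Q i) with hC
  set C' : (Fin N → ℝ) → (Fin N → ℝ) →L[ℝ] (Fin N → ℝ) := fun y =>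
    ContinuousLinearMap.pi fun i =>
      ((aeval y (Q i))⁻¹ • fderiv ℝ (fun x : Fin N → ℝ => aeval x (P i)) y -
        (aeval y (P i) / aeval y (Q i) ^ 2) • fderiv ℝ (fun x : Fin N → ℝ => aeval x (Q i)) y)
    with hC'
  have hderiv : ∀ y ∈ D, HasFDerivWithinAt C (C' y) D y := fun y hy =>
    (hasFDerivAt_pi.2 fun i => hasFDerivAt_aeval_div (P i) (Q i) y (hQ y hy i)).hasFDerivWithinAt
  have hdet : ∀ y ∈ D, (C' y).det = aeval y JP / aeval y JQ := by
    intro y hy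
    have hM : LinearMap.toMatrix' (C' y : (Fin N → ℝ) →ₗ[ℝ] (Fin N → ℝ)) =
        Matrix.of fun i j => (aeval y (Q i))⁻¹ * aeval y (pderiv j (P i)) -
          aeval y (P i) / aeval y (Q i) ^ 2 * aeval y (pderiv j (Q i)) := by
      ext i j
      rw [LinearMap.toMatrix'_apply, Matrix.of_apply]
      simp only [hC', ContinuousLinearMap.coe_coe, ContinuousLinearMap.pi_apply,
        FunLike.coe_sub, FunLike.coe_smul, Pi.sub_apply,
        Pi.smul_apply, smul_eq_mul, fderiv_aeval_single]
    rw [ContinuousLinearMap.det, ← LinearMap.det_toMatrix', hM, hJ y hy]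
  have hCsa : IsSemialgebraicMapOn ℚ D C :=
    IsSemialgebraicMapOn.of_forall hD fun i => isSemialgebraicFunOn_aeval_div_aeval hD (P i) (Q i)
      fun y hy => hQ y hy i
  have hJsa : IsSemialgebraicFunOn ℚ D (fun y => |aeval y JP / aeval y JQ|) :=
    (isSemialgebraicFunOn_aeval_div_aeval hD JP JQ hJQ).abs
  exact BeukersZeta3.chart_transport hD C C' (fun y => aeval y JP / aeval y JQ) hCsa hderiv hdet
    hJsa hinj g h hgh

/-! ## Reverse Newton–Leibniz unfolding with semialgebraic fibre ends -/

/-- **Reverse Newton–Leibniz unfolding of a letter-free coordinate, semialgebraic fibre ends**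
(one rule-3 move followed by a null change of domain): if `a < b` are `ℚ`-semialgebraic functions on
the domain `τ` of `r₀`, `g` is `ℚ`-semialgebraic on `τ`, and `r₀.integrand = (b − a)·g` on `τ`, then
`[r₀] ≡ [{(x,t) | x ∈ τ, a x < t < b x}, g ∘ init]`: rule 3 along the last coordinate with the
primitive `F (x,t) = (t − a x)·g x` on the closed band, then the null opening of the fibres
(the two graphs `t = a x`, `t = b x` are null). Integrability of the band side is Tonelli:
`∫|g ∘ init| = ∫ (b − a)|g|`. [cite: KontsevichZagier2001, §1.2 rule (3)] -/
theorem exists_unfold_step_fun {N : ℕ} (r₀ : KZ.IntegralRep N) (a b g : (Fin N → ℝ) → ℝ)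
    (ha : IsSemialgebraicFunOn ℚ r₀.domain a) (hb : IsSemialgebraicFunOn ℚ r₀.domain b)
    (hg : IsSemialgebraicFunOn ℚ r₀.domain g)
    (hAB : ∀ x ∈ r₀.domain, a x < b x)
    (hint : EqOn r₀.integrand (fun x => (b x - a x) * g x) r₀.domain) :
    ∃ r₁ : KZ.IntegralRep (N + 1),
      r₁.domain = {z | (Fin.init z : Fin N → ℝ) ∈ r₀.domain ∧
        a (Fin.init z : Fin N → ℝ) < z (Fin.last N) ∧ z (Fin.last N) < b (Fin.init z : Fin N → ℝ)} ∧
      r₁.integrand = (fun z => g (Fin.init z)) ∧ KZ.of r₀ - KZ.of r₁ ∈ KZ.relations := by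
  have hBsa : IsSemialgebraic ℚ (KZlog.band r₀.domain a b) := KZlog.isSemialgebraic_band ha hb
  have hBm : MeasurableSet (KZlog.band r₀.domain a b) :=
    IsSemialgebraic.measurableSet_holds hBsa
  have hDm : MeasurableSet r₀.domain := KZ.IntegralRep.measurableSet_domain_holds r₀
  have hW : IsSemialgebraicFunOn ℚ (KZlog.band r₀.domain a b) (fun z => g (Fin.init z)) :=
    hg.comp_init_mono hBsa fun z hz => hz.1
  have hWint : IntegrableOn (fun z => g (Fin.init z)) (KZlog.band r₀.domain a b) := by
    refine KZlog.integrableOn_band_of_lintegral_fibre_le hDm hBm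
      (fun x t => KZlog.snoc_mem_band) (KZ.aestronglyMeasurable_of_isSemialgebraicFunOn hW hBm)
      (K := r₀.integrand) ?_ r₀.integrableOn
    intro x hx
    simp only [Fin.init_snoc]
    rw [setLIntegral_const, Real.volume_Icc, hint hx, enorm_mul,
      Real.enorm_of_nonneg (sub_nonneg.2 (hAB x hx).le), mul_comm]
  let r₁c : KZ.IntegralRep (N + 1) :=
    ⟨KZlog.band r₀.domain a b, fun z => g (Fin.init z), hBsa, hW, hWint⟩
  have hNL : KZ.of r₁c - KZ.of r₀ ∈ KZ.newtonLeibnizRel := by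
    refine ⟨N, r₁c, r₀, a, b, fun z => (z (Fin.last N) - a (Fin.init z)) * g (Fin.init z), ?_,
      ha, hb, fun x hx => (hAB x hx).le, rfl, ?_, ?_, ?_, rfl⟩
    · exact IsSemialgebraicFunOn.mul_holds (IsSemialgebraicFunOn.sub_holds
        (isSemialgebraicFunOn_apply hBsa (Fin.last N))
        (ha.comp_init_mono hBsa fun z hz => hz.1)) hW
    · intro x _
      simp only [Fin.snoc_last, Fin.init_snoc]
      fun_prop
    · intro x _ t _
      simp only [Fin.snoc_last, Fin.init_snoc, r₁c]
      simpa using ((hasDerivAt_id t).sub_const (a x)).mul_const (g x)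
    · intro x hx
      simp only [Fin.snoc_last, Fin.init_snoc]
      rw [hint hx]
      ring
  set O := {z : Fin (N + 1) → ℝ | (Fin.init z : Fin N → ℝ) ∈ r₀.domain ∧
    a (Fin.init z : Fin N → ℝ) < z (Fin.last N) ∧ z (Fin.last N) < b (Fin.init z : Fin N → ℝ)}
    with hO_def
  -- the two graphs bounding the band
  set Ga := {z : Fin (N + 1) → ℝ | Fin.init z ∈ r₀.domain ∧ z (Fin.last N) = a (Fin.init z)}
    with hGa_def
  set Gb := {z : Fin (N + 1) → ℝ | Fin.init z ∈ r₀.domain ∧ z (Fin.last N) = b (Fin.init z)}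
    with hGb_def
  have hGa : IsSemialgebraic ℚ Ga := isSemialgebraicFunOn_iff.mp ha
  have hGb : IsSemialgebraic ℚ Gb := isSemialgebraicFunOn_iff.mp hb
  have hOeq : O = KZlog.band r₀.domain a b \ (Ga ∪ Gb) := by
    ext z
    simp only [hO_def, hGa_def, hGb_def, KZlog.mem_band, mem_sdiff, mem_union, mem_setOf_eq]
    constructor
    · rintro ⟨hzD, h1, h2⟩
      exact ⟨⟨hzD, h1.le, h2.le⟩, fun h => h.elim (fun h => h1.ne' h.2) (fun h => h2.ne h.2)⟩
    · rintro ⟨⟨hzD, h1, h2⟩, hno⟩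
      refine ⟨hzD, lt_of_le_of_ne h1 fun h => hno (Or.inl ⟨hzD, h.symm⟩),
        lt_of_le_of_ne h2 fun h => hno (Or.inr ⟨hzD, h⟩)⟩
  have hO : IsSemialgebraic ℚ O := by
    rw [hOeq]
    exact hBsa.diff (hGa.union hGb)
  have hOsub : O ⊆ KZlog.band r₀.domain a b := fun z hz => ⟨hz.1, hz.2.1.le, hz.2.2.le⟩
  have hnull : volume (KZlog.band r₀.domain a b \ O) = 0 := by
    refine measure_mono_null (fun z hz => ?_)
      (measure_union_null (KZ.volume_graph_eq_zero ha) (KZ.volume_graph_eq_zero hb))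
    obtain ⟨⟨hzD, h1, h2⟩, hzO⟩ := hz
    rcases h1.lt_or_eq with h1 | h1
    · rcases h2.lt_or_eq with h2 | h2
      · exact (hzO ⟨hzD, h1, h2⟩).elim
      · exact Or.inr ⟨hzD, h2⟩
    · exact Or.inl ⟨hzD, h1.symm⟩
  refine ⟨r₁c.restrict O hO hOsub, rfl, rfl, ?_⟩
  have h1 := r₁c.of_sub_of_restrict_mem_relations hO hOsub hnull
  have h2 := KZ.newtonLeibnizRel_subset_relations hNL
  have : KZ.of r₀ - KZ.of (r₁c.restrict O hO hOsub) =
      (KZ.of r₁c - KZ.of (r₁c.restrict O hO hOsub)) - (KZ.of r₁c - KZ.of r₀) := by abel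
  rw [this]
  exact KZ.relations.sub_mem h1 h2

/-! ## Natural multiples of an integrand -/

/-- **Iterated integrand additivity**: if `Z = [σ, g]` and `R = [σ, c·g]` (on `σ`) with `c : ℕ`,
then `[R] − c·[Z] ∈ relations` (`c·g = (c−1)·g + g`, rule (1b), induction on `c`; the
intermediate representations `[σ, k·g]` are the scalings `Z.constMul k`).
[cite: KontsevichZagier2001, §1.2 rule (1)] -/
theorem of_sub_nsmul_of_mem_relations {n : ℕ} (c : ℕ) :
    ∀ (R Z : KZ.IntegralRep n), Z.domain = R.domain →
      EqOn R.integrand (fun x => (c : ℝ) * Z.integrand x) R.domain →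
      KZ.of R - c • KZ.of Z ∈ KZ.relations := by
  induction c with
  | zero =>
    intro R Z _ h
    rw [zero_smul, sub_zero]
    exact KZ.of_mem_relations_of_eqOn_zero R fun x hx => by simpa using h hx
  | succ c ih =>
    intro R Z hd h
    let R' : KZ.IntegralRep n := Z.constMul (c : ℝ) (isAlgebraic_nat c)
    have hR'd : R'.domain = Z.domain := rfl
    have hadd : KZ.of R - KZ.of R' - KZ.of Z ∈ KZ.integrandAddRel := by
      refine ⟨n, R, R', Z, by rw [hR'd, hd], hd, fun x hx => ?_, rfl⟩
      rw [h hx]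
      simp only [Pi.add_apply, R', KZ.IntegralRep.integrand_constMul]
      push_cast
      ring
    have hih := ih R' Z rfl fun x _ => rfl
    have : KZ.of R - (c + 1) • KZ.of Z = (KZ.of R - KZ.of R' - KZ.of Z) + (KZ.of R' - c • KZ.of Z) := by
      rw [add_smul, one_smul]; abel
    rw [this]
    exact KZ.relations.add_mem (KZ.integrandAddRel_subset_relations hadd) hih

/-! ## The two word representations of weight three -/

/-- The typed simplex `{1 > t₀ > t₁ > t₂ > 0}` is the library's `KZ.openOrderedSimplex 3`.
[folklore] -/
theorem typedSimplex_eq_openOrderedSimplex :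
    {t : Fin 3 → ℝ | 1 > t 0 ∧ t 0 > t 1 ∧ t 1 > t 2 ∧ t 2 > 0} = KZ.openOrderedSimplex 3 := by
  ext t
  simp only [KZ.openOrderedSimplex, mem_setOf_eq]
  constructor
  · rintro ⟨h0, h01, h12, h2⟩
    refine ⟨?_, ?_, ?_⟩
    · intro i; fin_cases i <;> simp <;> linarith
    · intro i; fin_cases i <;> simp <;> linarith
    · rw [Fin.strictAnti_iff_succ_lt]
      intro i; fin_cases i <;> simp <;> linarith
  · rintro ⟨hpos, hlt, hanti⟩
    exact ⟨hlt 0, hanti (by decide : (0 : Fin 3) < 1), hanti (by decide : (1 : Fin 3) < 2), hpos 2⟩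

/-- The typed simplex is `ℚ`-semialgebraic. [folklore] -/
theorem isSemialgebraic_typedSimplex :
    IsSemialgebraic ℚ {t : Fin 3 → ℝ | 1 > t 0 ∧ t 0 > t 1 ∧ t 1 > t 2 ∧ t 2 > 0} := by
  rw [typedSimplex_eq_openOrderedSimplex]; exact KZ.isSemialgebraic_openOrderedSimplex 3

/-- **The `ζ(3)` word representation exists** on the typed simplex: `[1>t₀>t₁>t₂>0, 1/(t₀t₁(1−t₂))]`
(absolute convergence: `KZ.integrableOn_prod_mzvForm`, first letter `0`, last letter `1`).
[cite: Zagier1994, §9] -/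
theorem exists_zeta3Word_rep :
    ∃ Z : KZ.IntegralRep 3, Z.domain = {t : Fin 3 → ℝ | 1 > t 0 ∧ t 0 > t 1 ∧ t 1 > t 2 ∧ t 2 > 0} ∧
      Z.integrand = fun t => 1 / (t 0 * t 1 * (1 - t 2)) := by
  have hint : IntegrableOn (fun t : Fin 3 → ℝ => 1 / (t 0 * t 1 * (1 - t 2)))
      {t : Fin 3 → ℝ | 1 > t 0 ∧ t 0 > t 1 ∧ t 1 > t 2 ∧ t 2 > 0} volume := by
    rw [typedSimplex_eq_openOrderedSimplex]
    have h := KZ.integrableOn_prod_mzvForm 3 (fun k : ℕ => if k = 2 then true else false)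
      (fun _ => rfl) (fun _ => rfl)
    refine h.congr_fun (fun t _ => ?_) (KZ.measurableSet_openOrderedSimplex 3)
    simp only [Fin.prod_univ_three]
    norm_num [KZ.mzvForm]
    ring
  have hsa : IsSemialgebraicFunOn ℚ {t : Fin 3 → ℝ | 1 > t 0 ∧ t 0 > t 1 ∧ t 1 > t 2 ∧ t 2 > 0}
      (fun t : Fin 3 → ℝ => 1 / (t 0 * t 1 * (1 - t 2))) := by
    refine (isSemialgebraicFunOn_aeval_div_aeval isSemialgebraic_typedSimplex
      (1 : MvPolynomial (Fin 3) ℚ) (X 0 * X 1 * (1 - X 2)) ?_).congr ?_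
    · rintro t ⟨h0, h01, h12, h2⟩
      have : 0 < t 1 := by linarith
      have : 0 < t 0 := by linarith
      have : 0 < 1 - t 2 := by linarith
      simp only [map_mul, map_sub, map_one, aeval_X]
      positivity
    · intro t _
      simp
  exact ⟨⟨_, _, isSemialgebraic_typedSimplex, hsa, hint⟩, rfl, rfl⟩

/-- **The `ζ(2,1)` word representation exists** on the typed simplex:
`[1>t₀>t₁>t₂>0, 1/(t₀(1−t₁)(1−t₂))]`. [cite: Zagier1994, §9] -/
theorem exists_zeta21Word_rep :
    ∃ Z : KZ.IntegralRep 3, Z.domain = {t : Fin 3 → ℝ | 1 > t 0 ∧ t 0 > t 1 ∧ t 1 > t 2 ∧ t 2 > 0} ∧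
      Z.integrand = fun t => 1 / (t 0 * (1 - t 1) * (1 - t 2)) := by
  have hint : IntegrableOn (fun t : Fin 3 → ℝ => 1 / (t 0 * (1 - t 1) * (1 - t 2)))
      {t : Fin 3 → ℝ | 1 > t 0 ∧ t 0 > t 1 ∧ t 1 > t 2 ∧ t 2 > 0} volume := by
    rw [typedSimplex_eq_openOrderedSimplex]
    have h := KZ.integrableOn_prod_mzvForm 3 (fun k : ℕ => if k = 0 then false else true)
      (fun _ => rfl) (fun _ => rfl)
    refine h.congr_fun (fun t _ => ?_) (KZ.measurableSet_openOrderedSimplex 3)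
    simp only [Fin.prod_univ_three]
    norm_num [KZ.mzvForm]
    ring
  have hsa : IsSemialgebraicFunOn ℚ {t : Fin 3 → ℝ | 1 > t 0 ∧ t 0 > t 1 ∧ t 1 > t 2 ∧ t 2 > 0}
      (fun t : Fin 3 → ℝ => 1 / (t 0 * (1 - t 1) * (1 - t 2))) := by
    refine (isSemialgebraicFunOn_aeval_div_aeval isSemialgebraic_typedSimplex
      (1 : MvPolynomial (Fin 3) ℚ) (X 0 * (1 - X 1) * (1 - X 2)) ?_).congr ?_
    · rintro t ⟨h0, h01, h12, h2⟩
      have : 0 < t 0 := by linarith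
      have : 0 < 1 - t 1 := by linarith
      have : 0 < 1 - t 2 := by linarith
      simp only [map_mul, map_sub, map_one, aeval_X]
      positivity
    · intro t _
      simp
  exact ⟨⟨_, _, isSemialgebraic_typedSimplex, hsa, hint⟩, rfl, rfl⟩

/-- The duality involution `t ↦ (1 − t₂, 1 − t₁, 1 − t₀)` maps the typed simplex onto itself.
[cite: Zagier1994, §9] -/
theorem image_dualityChart :
    (fun (x : Fin 3 → ℝ) (i : Fin 3) => aeval x ((![1 - X 2, 1 - X 1, 1 - X 0] : Fin 3 →
        MvPolynomial (Fin 3) ℚ) i)) '' {t : Fin 3 → ℝ | 1 > t 0 ∧ t 0 > t 1 ∧ t 1 > t 2 ∧ t 2 > 0} =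
      {t : Fin 3 → ℝ | 1 > t 0 ∧ t 0 > t 1 ∧ t 1 > t 2 ∧ t 2 > 0} := by
  have happ : ∀ x : Fin 3 → ℝ, (fun i : Fin 3 => aeval x ((![1 - X 2, 1 - X 1, 1 - X 0] : Fin 3 →
      MvPolynomial (Fin 3) ℚ) i)) = ![1 - x 2, 1 - x 1, 1 - x 0] := by
    intro x; funext i; fin_cases i <;> simp
  ext t
  simp only [mem_image, mem_setOf_eq, happ]
  constructor
  · rintro ⟨x, ⟨h0, h01, h12, h2⟩, rfl⟩
    simp only [Matrix.cons_val_zero, Matrix.cons_val_one, Matrix.cons_val_two, Matrix.head_cons,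
      Matrix.tail_cons]
    refine ⟨?_, ?_, ?_, ?_⟩ <;> linarith
  · rintro ⟨h0, h01, h12, h2⟩
    refine ⟨![1 - t 2, 1 - t 1, 1 - t 0], ?_, ?_⟩
    · simp only [Matrix.cons_val_zero, Matrix.cons_val_one, Matrix.cons_val_two, Matrix.head_cons,
        Matrix.tail_cons]
      refine ⟨?_, ?_, ?_, ?_⟩ <;> linarith
    · funext i
      fin_cases i <;> simp

/-- **Duality `ζ(2,1) ~ ζ(3)` is one move**: for every `ζ(2,1)` word representation `Z'` and every
`ζ(3)` word representation `Z` on the typed simplex, `[Z'] − [Z] ∈ relations` (the affine involution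
`tᵢ ↦ 1 − t_{2−i}`: a polynomial change of variables of the simplex onto itself with `|det| = 1`
exchanging `ω₀ ↔ ω₁` and reversing the letters). [cite: Zagier1994, §9] -/
theorem zeta21Word_sub_zeta3Word_mem_relations (Z Z' : KZ.IntegralRep 3)
    (hZd : Z.domain = {t : Fin 3 → ℝ | 1 > t 0 ∧ t 0 > t 1 ∧ t 1 > t 2 ∧ t 2 > 0})
    (hZi : EqOn Z.integrand (fun t => 1 / (t 0 * t 1 * (1 - t 2))) Z.domain)
    (hZ'd : Z'.domain = {t : Fin 3 → ℝ | 1 > t 0 ∧ t 0 > t 1 ∧ t 1 > t 2 ∧ t 2 > 0})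
    (hZ'i : EqOn Z'.integrand (fun t => 1 / (t 0 * (1 - t 1) * (1 - t 2))) Z'.domain) :
    KZ.of Z' - KZ.of Z ∈ KZ.relations := by
  have hT := BeukersZeta3.polyChart_transport (![1 - X 2, 1 - X 1, 1 - X 0]) 1
    isSemialgebraic_typedSimplex (fun y _ => by simp [Matrix.det_fin_three]) ?_
    (fun t => 1 / (t 0 * (1 - t 1) * (1 - t 2))) (fun t => 1 / (t 0 * t 1 * (1 - t 2))) ?_
  · exact hT.2.2 Z' Z hZ'd (hZ'd ▸ hZ'i) (by rw [image_dualityChart, hZd]) hZi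
  · intro x _ x' _ h
    have h0 := congrFun h 0
    have h1 := congrFun h 1
    have h2 := congrFun h 2
    simp only [Matrix.cons_val_zero, Matrix.cons_val_one, Matrix.cons_val_two, Matrix.head_cons,
      Matrix.tail_cons, map_sub, map_one, aeval_X] at h0 h1 h2
    funext i
    fin_cases i
    · show x 0 = x' 0; linarith
    · show x 1 = x' 1; linarith
    · show x 2 = x' 2; linarith
  · rintro y ⟨h0, h01, h12, h2⟩
    have happ : (fun i : Fin 3 => aeval y ((![1 - X 2, 1 - X 1, 1 - X 0] : Fin 3 →
        MvPolynomial (Fin 3) ℚ) i)) = ![1 - y 2, 1 - y 1, 1 - y 0] := by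
      funext i; fin_cases i <;> simp
    rw [happ]
    simp only [map_one, abs_one, mul_one, Matrix.cons_val_zero, Matrix.cons_val_one,
      Matrix.cons_val_two, Matrix.head_cons, Matrix.tail_cons, sub_sub_cancel]
    ring

end Summit.KontsevichZagierPeriods.LinRedNormalForm.WheelThreeSpokes
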